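import Mathlib.GroupTheory.Subgroup.Center
import Mathlib.Algebra.BigOperators.Group.List.Basic
import Mathlib.Tactic.Group
import HarnessLib

/-!
# Non-abelian Stokes on a periodic 2-torus slice with CENTRAL plaquettes: the two based Polyakov holonomies have
# commutator = (ordered product of the plaquette values)⁻¹

HELPER toward stub **T1** `TwistedSlabAnchor` (LINE `twisted-slab-continuity`, crux `IRcof` stmt-QuantumFields-26930, census row 43; LEAD
prover ym-ir-line-tsc-p1; `--supports` the crux, `--as helper`).  First file of the programme «the e₂-projection in T1 is LOAD-BEARING»
(seat memo `Cruxes/IRcof/T1-ANATOMY-tsc-p1.md`): the β → ∞ skeleton of T1's vacuum structure is the classification of zero-action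
configurations of twisted boxes, and its first step is this lattice Stokes lemma.

PURE GROUP ALGEBRA (any group `G`; no lattice gauge theory object is imported).  Data on the discrete plane `ℕ × ℕ` (the user supplies
periodic extensions): `u i j` = the link leaving `(i, j)` in the first direction, `v i j` = the link leaving `(i, j)` in the second
direction, plaquette holonomy `u i j · v (i+1) j · (u i (j+1))⁻¹ · (v i j)⁻¹`.

* `lprod f i = f 0 · f 1 ⋯ f (i−1)` — ORDERED partial products (`List.prod`; `G` need not be commutative);
* `row_transport` — if every plaquette of row `j` is CENTRAL, `= c i`, then the next row's partial holonomy is the transported one: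
  `lprod u' i = (lprod c i)⁻¹ · (v 0)⁻¹ · lprod u i · v i` (`u = u · j`, `u' = u · (j+1)`, `v = v · j`);
* `column_transport` — iterating a conjugation recursion `R (j+1) = (C j)⁻¹ · (y j)⁻¹ · R j · y j` with central `C j`:
  `R j = (lprod C j)⁻¹ · (lprod y j)⁻¹ · R 0 · lprod y j`;
* ★ `torus_holonomy_comm_eq` — on an `a × b` periodic torus (`v a j = v 0 j`, `u i b = u i 0`) whose EVERY plaquette holonomy is a
  central element `c i j`, the based Polyakov holonomies `h₁ = u 0 0 ⋯ u (a−1) 0`, `h₂ = v 0 0 ⋯ v 0 (b−1)` satisfy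
  `h₂ · h₁ · h₂⁻¹ · h₁⁻¹ = (∏_{j<b} ∏_{i<a} c i j)⁻¹` — a flat connection on a 2-torus with ONE twisted plaquette (value `w⁻¹`) has
  holonomies with commutator `w` (the twist is «eaten» by the holonomies; 't Hooft 1979 §3, González-Arroyo 1998 §4.2 ∕ §8.1,
  van Baal 1982 — the consistency condition of twisted boundary conditions, here on the lattice and for an arbitrary group).

Used by `BalabanLadderIRTwistedSlabNoFlat` (the slab with magnetic twist `z` on `(0,1)` and electric twist `z^k ≠ 1` on `(2,3)` has NO
zero-action configuration when the twist-eating pairs of `z` have central centraliser — `SU(N)`, `z` generating).  The symmetric-torus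
(`(ℤ/L)^d`) classification `Literature.MathematicalPhysics.QuantumLattice.exists_isTwistEater_of_isTwistedFlat` is the tree's; the present
file serves the ANISOTROPIC `Fin` boxes of `wilsonFinTorusTensorTwistedPartition` (the line's currency) and needs no quotient by the centre.

HONEST FRAMING: group algebra; nothing here bears on `IRcof`, `IR`, or the Yang–Mills mass gap (Clay: NOT proved); R4 = `BalabanLadder.UV` only.
References: G. 't Hooft, Nucl. Phys. B 153 (1979) 141, §3; A. González-Arroyo, hep-th/9807108 (1998) §4.2, §8.1; P. van Baal,
Commun. Math. Phys. 85 (1982) 529.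
-/

set_option autoImplicit false

namespace Summit.QuantumFields.YangMills.Cruxes.IRcof.TwistedSlab

variable {G : Type*} [Group G]

/-! ## §1 Ordered partial products -/

/-- The ORDERED partial product `f 0 · f 1 ⋯ f (i − 1)` of a sequence in a (non-commutative) group. [folklore] -/
def lprod (f : ℕ → G) (i : ℕ) : G := ((List.range i).map f).prod

/-- `lprod f 0 = 1`. [folklore] -/
@[simp] theorem lprod_zero (f : ℕ → G) : lprod f 0 = 1 := by
  simp [lprod]

/-- `lprod f (i+1) = lprod f i · f i`. [folklore] -/
theorem lprod_succ (f : ℕ → G) (i : ℕ) : lprod f (i + 1) = lprod f i * f i := by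
  simp [lprod, List.range_succ, List.map_append, List.prod_append]

/-- A partial product of central elements is central. [folklore] -/
theorem lprod_mem_center {f : ℕ → G} (hf : ∀ i, f i ∈ Subgroup.center G) (i : ℕ) : lprod f i ∈ Subgroup.center G := by
  induction i with
  | zero => rw [lprod_zero]; exact Subgroup.one_mem _
  | succ i ih => rw [lprod_succ]; exact Subgroup.mul_mem _ ih (hf i)

/-- Partial products of pointwise equal sequences agree (only the first `i` terms are read). [folklore] -/
theorem lprod_congr {f g : ℕ → G} {i : ℕ} (h : ∀ k, k < i → f k = g k) : lprod f i = lprod g i := by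
  induction i with
  | zero => simp
  | succ i ih =>
      rw [lprod_succ, lprod_succ, ih fun k hk => h k (Nat.lt_succ_of_lt hk), h i (Nat.lt_succ_self i)]

/-- The partial product of a sequence that is `1` below index `i` is `1`. [folklore] -/
theorem lprod_eq_one_of_forall_lt {f : ℕ → G} {i : ℕ} (hf : ∀ m, m < i → f m = 1) : lprod f i = 1 := by
  induction i with
  | zero => simp
  | succ i ih =>
      rw [lprod_succ, hf i (Nat.lt_succ_self i), mul_one]
      exact ih fun m hm => hf m (Nat.lt_succ_of_lt hm)

/-- The partial product of a sequence that is `1` away from ONE index `k < i` is its value there. [folklore] -/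
theorem lprod_eq_of_eq_one_off {f : ℕ → G} {k : ℕ} (hf : ∀ m, m ≠ k → f m = 1) {i : ℕ} (hk : k < i) :
    lprod f i = f k := by
  induction i with
  | zero => exact absurd hk (Nat.not_lt_zero _)
  | succ i ih =>
      rw [lprod_succ]
      rcases Nat.lt_succ_iff_lt_or_eq.1 hk with h | h
      · rw [ih h, hf i (Nat.ne_of_gt h), mul_one]
      · subst h
        rw [lprod_eq_one_of_forall_lt fun m hm => hf m (Nat.ne_of_lt hm), one_mul]

/-- The partial product of the constant sequence `1` is `1`. [folklore] -/
theorem lprod_one (i : ℕ) : lprod (fun _ => (1 : G)) i = 1 := by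
  induction i with
  | zero => simp
  | succ i ih => rw [lprod_succ, ih, mul_one]

/-! ## §2 Transport along one row of central plaquettes -/

/-- **Row transport.**  If the plaquettes of a row are central, `u i · v (i+1) · (u' i)⁻¹ · (v i)⁻¹ = c i` with `c i ∈ Z(G)`, then
the partial holonomy of the upper row is the lower one transported: `lprod u' i = (lprod c i)⁻¹ · (v 0)⁻¹ · lprod u i · v i`.
[folklore] -/
theorem row_transport {u u' v c : ℕ → G} (hc : ∀ i, c i ∈ Subgroup.center G)
    (hP : ∀ i, u i * v (i + 1) * (u' i)⁻¹ * (v i)⁻¹ = c i) (i : ℕ) :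
    lprod u' i = (lprod c i)⁻¹ * (v 0)⁻¹ * lprod u i * v i := by
  induction i with
  | zero => simp
  | succ i ih =>
      -- solve the plaquette relation for the upper link: `u' i = (c i)⁻¹ · (v i)⁻¹ · u i · v (i+1)`
      have hci : ∀ g : G, g * c i = c i * g := fun g => (Subgroup.mem_center_iff.mp (hc i) g)
      have hu' : u' i = (c i)⁻¹ * ((v i)⁻¹ * u i * v (i + 1)) := by
        have h := hP i
        -- `u v₊ u'⁻¹ v⁻¹ = c` ⇒ `u v₊ = c v u'` ⇒ `u' = (c v)⁻¹-transport`
        have h1 : u i * v (i + 1) = c i * (v i * u' i) := by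
          calc u i * v (i + 1) = (u i * v (i + 1) * (u' i)⁻¹ * (v i)⁻¹) * (v i * u' i) := by group
            _ = c i * (v i * u' i) := by rw [h]
        have h2 : u' i = (v i)⁻¹ * ((c i)⁻¹ * (u i * v (i + 1))) := by
          rw [h1]; group
        rw [h2]
        have h3 : (c i)⁻¹ * (v i)⁻¹ = (v i)⁻¹ * (c i)⁻¹ := by
          have := hci (v i)⁻¹
          calc (c i)⁻¹ * (v i)⁻¹ = (c i)⁻¹ * ((v i)⁻¹ * c i) * (c i)⁻¹ := by group
            _ = (c i)⁻¹ * (c i * (v i)⁻¹) * (c i)⁻¹ := by rw [this]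
            _ = (v i)⁻¹ * (c i)⁻¹ := by group
        calc (v i)⁻¹ * ((c i)⁻¹ * (u i * v (i + 1))) = ((v i)⁻¹ * (c i)⁻¹) * (u i * v (i + 1)) := by group
          _ = ((c i)⁻¹ * (v i)⁻¹) * (u i * v (i + 1)) := by rw [h3]
          _ = (c i)⁻¹ * ((v i)⁻¹ * u i * v (i + 1)) := by group
      -- the central factor `(c i)⁻¹` commutes past everything
      have hcinv : ∀ g : G, g * (c i)⁻¹ = (c i)⁻¹ * g := fun g =>
        Subgroup.mem_center_iff.mp (Subgroup.inv_mem _ (hc i)) g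
      rw [lprod_succ, lprod_succ, lprod_succ, ih, hu', mul_inv_rev]
      calc (lprod c i)⁻¹ * (v 0)⁻¹ * lprod u i * v i * ((c i)⁻¹ * ((v i)⁻¹ * u i * v (i + 1)))
          = (lprod c i)⁻¹ * (((v 0)⁻¹ * lprod u i * v i) * (c i)⁻¹) * ((v i)⁻¹ * u i * v (i + 1)) := by group
        _ = (lprod c i)⁻¹ * ((c i)⁻¹ * ((v 0)⁻¹ * lprod u i * v i)) * ((v i)⁻¹ * u i * v (i + 1)) := by rw [hcinv]
        _ = (c i)⁻¹ * (lprod c i)⁻¹ * (v 0)⁻¹ * (lprod u i * u i) * v (i + 1) := by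
            have h4 : (lprod c i)⁻¹ * (c i)⁻¹ = (c i)⁻¹ * (lprod c i)⁻¹ := hcinv _
            calc (lprod c i)⁻¹ * ((c i)⁻¹ * ((v 0)⁻¹ * lprod u i * v i)) * ((v i)⁻¹ * u i * v (i + 1))
                = ((lprod c i)⁻¹ * (c i)⁻¹) * (v 0)⁻¹ * (lprod u i * u i) * v (i + 1) := by group
              _ = ((c i)⁻¹ * (lprod c i)⁻¹) * (v 0)⁻¹ * (lprod u i * u i) * v (i + 1) := by rw [h4]
              _ = (c i)⁻¹ * (lprod c i)⁻¹ * (v 0)⁻¹ * (lprod u i * u i) * v (i + 1) := by group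

/-! ## §3 Transport along the column of rows -/

/-- **Column transport.**  A conjugation recursion with central prefactors, `R (j+1) = (C j)⁻¹ · (y j)⁻¹ · R j · y j`, integrates to
`R j = (lprod C j)⁻¹ · (lprod y j)⁻¹ · R 0 · lprod y j`. [folklore] -/
theorem column_transport {R y C : ℕ → G} (hC : ∀ j, C j ∈ Subgroup.center G)
    (hR : ∀ j, R (j + 1) = (C j)⁻¹ * (y j)⁻¹ * R j * y j) (j : ℕ) :
    R j = (lprod C j)⁻¹ * (lprod y j)⁻¹ * R 0 * lprod y j := by
  induction j with
  | zero => simp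
  | succ j ih =>
      have hcinv : ∀ g : G, g * (C j)⁻¹ = (C j)⁻¹ * g := fun g =>
        Subgroup.mem_center_iff.mp (Subgroup.inv_mem _ (hC j)) g
      rw [hR j, ih, lprod_succ, lprod_succ, mul_inv_rev, mul_inv_rev]
      calc (C j)⁻¹ * (y j)⁻¹ * ((lprod C j)⁻¹ * (lprod y j)⁻¹ * R 0 * lprod y j) * y j
          = (C j)⁻¹ * ((y j)⁻¹ * (lprod C j)⁻¹) * (lprod y j)⁻¹ * R 0 * (lprod y j * y j) := by group
        _ = (C j)⁻¹ * ((lprod C j)⁻¹ * (y j)⁻¹) * (lprod y j)⁻¹ * R 0 * (lprod y j * y j) := by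
            rw [show (y j)⁻¹ * (lprod C j)⁻¹ = (lprod C j)⁻¹ * (y j)⁻¹ from
              Subgroup.mem_center_iff.mp (Subgroup.inv_mem _ (lprod_mem_center hC j)) _]
        _ = (C j)⁻¹ * (lprod C j)⁻¹ * ((y j)⁻¹ * (lprod y j)⁻¹) * R 0 * (lprod y j * y j) := by group

/-! ## §4 The torus: commutator of the based holonomies -/

/-- ★ **Non-abelian Stokes on a periodic 2-torus with central plaquettes.**  Let `a, b ≥ 1` and let `u v : ℕ → ℕ → G` be link variables
with the periodicity actually used (`v a j = v 0 j` for all `j`, `u i b = u i 0` for all `i`), such that EVERY plaquette holonomy is a central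
element: `u i j · v (i+1) j · (u i (j+1))⁻¹ · (v i j)⁻¹ = c i j ∈ Z(G)`.  Then the based Polyakov holonomies `h₁ := u 0 0 · u 1 0 ⋯ u (a−1) 0`
and `h₂ := v 0 0 · v 0 1 ⋯ v 0 (b−1)` satisfy `h₂ · h₁ · h₂⁻¹ · h₁⁻¹ = (∏_{j<b} ∏_{i<a} c i j)⁻¹` (ordered products; the order is
immaterial since the `c i j` are central).  With one twisted plaquette of value `w⁻¹` this is 't Hooft's consistency condition
`Ω_ν Ω_μ Ω_ν⁻¹ Ω_μ⁻¹ = w` for the transition functions of a flat twisted connection. [folklore] -/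
theorem torus_holonomy_comm_eq {a b : ℕ} {u v c : ℕ → ℕ → G} (hc : ∀ i j, c i j ∈ Subgroup.center G)
    (hP : ∀ i j, u i j * v (i + 1) j * (u i (j + 1))⁻¹ * (v i j)⁻¹ = c i j)
    (hva : ∀ j, v a j = v 0 j) (hub : ∀ i, i < a → u i b = u i 0) :
    lprod (fun j => v 0 j) b * lprod (fun i => u i 0) a * (lprod (fun j => v 0 j) b)⁻¹ * (lprod (fun i => u i 0) a)⁻¹ =
      (lprod (fun j => lprod (fun i => c i j) a) b)⁻¹ := by
  -- rows `R j := u 0 j ⋯ u (a−1) j`, their central plaquette products `C j := c 0 j ⋯ c (a−1) j`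
  set R : ℕ → G := fun j => lprod (fun i => u i j) a with hRdef
  set C : ℕ → G := fun j => lprod (fun i => c i j) a with hCdef
  have hCc : ∀ j, C j ∈ Subgroup.center G := fun j => lprod_mem_center (fun i => hc i j) a
  -- row transport at full length `a`, closed up by `v a j = v 0 j`
  have hRsucc : ∀ j, R (j + 1) = (C j)⁻¹ * (v 0 j)⁻¹ * R j * v 0 j := fun j => by
    have h := row_transport (u := fun i => u i j) (u' := fun i => u i (j + 1)) (v := fun i => v i j) (c := fun i => c i j)
      (fun i => hc i j) (fun i => hP i j) a
    simp only [hRdef, hCdef]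
    rw [h, hva j]
  -- column transport up to height `b`, closed up by `u i b = u i 0`
  have hRb : R b = (lprod C b)⁻¹ * (lprod (fun j => v 0 j) b)⁻¹ * R 0 * lprod (fun j => v 0 j) b :=
    column_transport (R := R) (y := fun j => v 0 j) (C := C) hCc hRsucc b
  have hR0 : R b = R 0 := by
    simp only [hRdef]
    exact lprod_congr fun i hi => hub i hi
  -- `R 0 = L⁻¹ V⁻¹ R 0 V` with `L` central ⇒ `V R0 V⁻¹ R0⁻¹ = L⁻¹`
  have hLc : ∀ g : G, g * (lprod C b)⁻¹ = (lprod C b)⁻¹ * g := fun g =>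
    Subgroup.mem_center_iff.mp (Subgroup.inv_mem _ (lprod_mem_center hCc b)) g
  rw [hR0] at hRb
  -- abbreviations (definitional): `V = h₂`, `R 0 = h₁`
  have hgoal : ∀ {V R0 L : G}, (∀ g : G, g * L⁻¹ = L⁻¹ * g) → R0 = L⁻¹ * V⁻¹ * R0 * V →
      V * R0 * V⁻¹ * R0⁻¹ = L⁻¹ := by
    intro V R0 L hL hRb
    have h1 : V * R0 = L⁻¹ * (R0 * V) := by
      calc V * R0 = V * (L⁻¹ * V⁻¹ * R0 * V) := by rw [← hRb]
        _ = (V * L⁻¹) * (V⁻¹ * R0 * V) := by group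
        _ = (L⁻¹ * V) * (V⁻¹ * R0 * V) := by rw [hL]
        _ = L⁻¹ * (R0 * V) := by group
    calc V * R0 * V⁻¹ * R0⁻¹ = (V * R0) * (R0 * V)⁻¹ := by group
      _ = L⁻¹ * (R0 * V) * (R0 * V)⁻¹ := by rw [h1]
      _ = L⁻¹ := by group
  exact hgoal hLc hRb

end Summit.QuantumFields.YangMills.Cruxes.IRcof.TwistedSlab
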